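import Mathlib
import HarnessLib

/-!
# `[p]` on a commutative bialgebra in characteristic `p`: Tate's Lemma 3.7.3 `[p] I ⊂ I^p`, and for finite free
# cocommutative `B` the sharpening `[p^f] x ∈ span_R {b^{p^f}}` («`V ∘ F = p`» in absolute currency, [SGA3I] VII_A 4.3)

Topic `RingTheory/HopfAlgebra`; namespace `Literature.RingTheory.HopfAlgebra`.  THEOREMS ONLY (no definition ∕ instance ∕ notation ∕
named fact ∕ `sorry`); Mathlib-only.  Cell `pub/hodgecm-mathlib` (D-0151), FLOOR 0, F0P5a (stmt-HodgeConjecture-24832; PLAN v4.1 §2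
row H-CD, KF8; MOD-ROAD-P″ add2 §B3 [h6], §B5), row **G19** (F0P5a-plan (g5) GO 2026-08-31T08:36:47Z); road-independent algebra.

SETTING.  `R` commutative ring of prime characteristic `p`; `B` a commutative `R`-bialgebra (`G = Spec B` an affine group scheme over
the `𝔽_p`-scheme `Spec R`); `I = ker ε` the augmentation ideal; multiplication by `n` on `G` is the convolution power `[n] = id^{*n}`
in Mathlib's `WithConv (B →ₗ[R] B)` ∕ `WithConv (B →ₐ[R] B)` ([Tate1997FiniteFlatGroupSchemes] §3.7 Notation: `([m] f)(x) = f(x^m)`).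
* §5 **[Tate1997FiniteFlatGroupSchemes] Lemma 3.7.3** (for EVERY commutative bialgebra — no finiteness, no cocommutativity):
  `[p^m] x − ε(x)·1 ∈ I^{p^m}` (`convPow_id_prime_pow_apply_sub_mem_pow`), hence **`[p^m](I) ⊂ I^{p^m}`**
  (`map_convPow_id_ker_counit_le_pow`).  Proof: in the convolution ring (characteristic `p`; `id` commutes with `1 = η ∘ ε`)
  `[p^m] − 1 = (id − 1)^{p^m}` and the `n`-th convolution power of `π = id − 1 : x ↦ x − ε(x)·1` lands in `Iⁿ`
  (`convPow_id_sub_one_apply_mem_pow`) — Tate's `U^p − 1 = (U − 1)^p` without the regular representation.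
* §2 for `B` moreover COCOMMUTATIVE and FINITE FREE with basis `e` (finite free commutative group scheme), the sharper
  **`[p^f] x = Σᵢ (eⁱ)^{p^f}(x) • (e i)^{p^f}`** (`convPow_id_prime_pow_eq_sum`, `…_apply`; `(eⁱ)^{p^f}` the convolution power
  of the coordinate functional in the dual algebra `WithConv (Module.Dual R B)`), so **`[p^f] x ∈ span_R {b^{p^f}}`**
  (`convPow_id_prime_pow_mem_span`): `[p^f]` FACTORS THROUGH THE `f`-TH RELATIVE FROBENIUS — the def-free content of
  `V_G ∘ F_G = p·id_G` ([SGA3I] VII_A 4.3), proved by Cartier's trick: `WithConv (B →ₗ[R] B)` is COMMUTATIVE of characteristic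
  `p` (Mathlib `LinearMap.convCommRing`), `id = Σ uᵢ` with rank-one `uᵢ = eⁱ • e i` (§1), so `id^{p^f} = Σ uᵢ^{p^f}`, and
  rank-one maps power coefficient-wise (§1 `smulRight_convMul_smulRight`, `smulRight_convPow`).
* §3 `ε ∘ [n] = ε`; **`x ∈ I ⇒ [p^f] x ∈ span_R {b^{p^f} : b ∈ I}`** (`convPow_id_prime_pow_mem_span_of_mem_ker`).
* §4 group-scheme dress: **`[p^f]^*(I)·B ≤ (b^{p^f} : b ∈ I)·B`** (`map_convPow_id_ker_counit_le_span_pow`), i.e.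
  **`ker F_G^f ⊆ G[p^f]`** as closed subgroup schemes ([Tate1997FiniteFlatGroupSchemes] §3.7: `Ker F = Spec k[x]⧸(xᵢ^p)`) for
  every finite free commutative group scheme over a base of characteristic `p`, WITHOUT Cartier duality or a Verschiebung;
  if `F^f` kills `G` then `[p^f] = 1` (`algHom_convPow_id_prime_pow_eq_one`) and every point `g ∈ G(R') = WithConv (B →ₐ[R] R')`
  has `g ^ p^f = 1` (`convPow_prime_pow_eq_one_of_forall_pow_eq_zero`; points compose as `g ∘ [n] = gⁿ`, `comp_algHom_convPow_id`).
Related tree results: ★ `Literature.NumberTheory.DiophantineGeometry.Deligne.convPow_finrank_eq_one` (Deligne «killed by the order»,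
same convolution dress), ★ `Motives/AbelianVarietyVerschiebung` (`[p^r]_A = F^{(r)} ≫ V` for abelian varieties over a perfect
field), ★ `Literature.RingTheory.Etale.span_qPow_eq_bot_iff_forall_pow_eq_zero` (G16, the «span of `q`-th powers» currency).
HC_CM is proved only modulo the 7 printed citations until rung 0 closes; this file is generic algebra and changes no count.

## References
* [Tate1997FiniteFlatGroupSchemes] J. Tate, *Finite flat group schemes*, in: Modular Forms and Fermat's Last Theorem (1997), §3.7:
  Notation `[m]`, **Lemma 3.7.3** («`pR = 0`, `G` finite free or closed in `GL_n` ⇒ `[p] I ⊂ I^p`»; pp. 141–142 (held e-text chunks p0198–p0199), incl.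
  «iterating `m` times gives `[q](I) ⊂ I^q`»), `Ker F = Spec(k[x]⧸(xᵢ^p))`; §(3.8) the dual Hopf algebra `A'` (pp. 143–145).
* [SGA3I] M. Demazure, A. Grothendieck (eds.), *Schémas en groupes I* (SGA 3, tome I), LNM 151 (1970), Exp. VII_A (P. Gabriel) §4.3:
  `V_G ∘ F_G = p · id_G` for commutative flat `G` over a base of characteristic `p`.
-/

set_option autoImplicit false

noncomputable section

open TensorProduct WithConv Coalgebra Module

namespace Literature.RingTheory.HopfAlgebra

universe u v w

/-! ## §1 Rank-one maps in Mathlib's convolution algebra `WithConv (C →ₗ[R] A)` -/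

section RankOne

variable {R : Type u} [CommSemiring R] {C : Type v} [AddCommMonoid C] [Module R C] [Coalgebra R C]
  {A : Type w} [Semiring A] [Algebra R A]

/-- **rank-one maps multiply coefficient-wise**: for functionals `φ ψ : C → R` and `a b : A`, the convolution product
of the rank-one maps `c ↦ φ c • a` and `c ↦ ψ c • b` is the rank-one map `c ↦ (φ * ψ) c • (a * b)`, where `φ * ψ` is the
convolution product of functionals in the dual algebra `WithConv (Module.Dual R C)` (the multiplication of `A' ⊗_R A` for the dual
algebra `A'` of [Tate1997FiniteFlatGroupSchemes] §3.8). [cite: Tate1997FiniteFlatGroupSchemes, §(3.8) pp. 143–144] -/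
theorem smulRight_convMul_smulRight (φ ψ : Module.Dual R C) (a b : A) :
    toConv (φ.smulRight a) * toConv (ψ.smulRight b) =
      toConv ((toConv φ * toConv ψ : WithConv (Module.Dual R C)).ofConv.smulRight (a * b)) := by
  apply WithConv.ext
  ext c
  change (toConv (φ.smulRight a) * toConv (ψ.smulRight b)) c =
    (toConv φ * toConv ψ : WithConv (Module.Dual R C)) c • (a * b)
  rw [(ℛ R c).convMul_apply, (ℛ R c).convMul_apply, Finset.sum_smul]
  refine Finset.sum_congr rfl fun i _ => ?_
  change (φ _ • a) * (ψ _ • b) = _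
  rw [smul_mul_smul_comm]

/-- **convolution powers of a rank-one map**: `(c ↦ φ c • a) ^ n = (c ↦ (φ ^ n) c • a ^ n)`, with `φ ^ n` the convolution
power in `WithConv (Module.Dual R C)` (for `n = 0` both sides are the unit `c ↦ ε c • 1`).
[cite: Tate1997FiniteFlatGroupSchemes, §(3.8) pp. 143–144] -/
theorem smulRight_convPow (φ : Module.Dual R C) (a : A) (n : ℕ) :
    toConv (φ.smulRight a) ^ n =
      toConv ((toConv φ ^ n : WithConv (Module.Dual R C)).ofConv.smulRight (a ^ n)) := by
  induction n with
  | zero =>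
    rw [pow_zero, pow_zero, pow_zero]
    apply WithConv.ext
    ext c
    change (1 : WithConv (C →ₗ[R] A)) c = (1 : WithConv (Module.Dual R C)) c • (1 : A)
    rw [LinearMap.convOne_apply, LinearMap.convOne_apply, Algebra.algebraMap_eq_smul_one]
    rfl
  | succ n ih =>
    rw [pow_succ, ih, smulRight_convMul_smulRight, ← pow_succ, ← pow_succ]

/-- **the identity is the sum of the rank-one maps of a basis**: `id = Σᵢ (m ↦ eⁱ(m) • e i)` in `WithConv (M →ₗ[R] M)`
for a finite basis `e` of `M` with coordinate functionals `eⁱ = e.coord i` (the element `id ∈ A' ⊗_R A` of [Tate1997FiniteFlatGroupSchemes]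
§3.8, Lemma 3.8.2). [cite: Tate1997FiniteFlatGroupSchemes, §(3.8) p. 144 (Lemma 3.8.2)] -/
theorem toConv_id_eq_sum_smulRight {M : Type v} [AddCommMonoid M] [Module R M] {ι : Type w} [Fintype ι]
    (e : Basis ι R M) :
    (toConv LinearMap.id : WithConv (M →ₗ[R] M)) = ∑ i, toConv ((e.coord i).smulRight (e i)) := by
  rw [← toConv_sum]
  congr 1
  ext m
  simp only [LinearMap.id_coe, id_eq, LinearMap.coe_sum, Finset.sum_apply, LinearMap.smulRight_apply,
    Basis.coord_apply]
  exact (e.sum_repr m).symm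

end RankOne

/-! ## §2 `[p^f]` is the sum of the rank-one maps `(eⁱ)^{p^f} • (e i)^{p^f}`; it lands in the span of the `p^f`-th powers -/

section CharP

variable {R : Type u} [CommRing R] {B : Type v} [CommRing B] [Bialgebra R B] (p : ℕ) [CharP R p]

/-- In characteristic `p` the convolution ring `WithConv (B →ₗ[R] B)` has `(p : _) = 0`
(`p • 1 = (x ↦ p · ε(x) · 1) = 0`). [folklore] -/
private theorem natCast_conv_eq_zero : (p : WithConv (B →ₗ[R] B)) = 0 := by
  rw [← Nat.smul_one_eq_cast]
  apply WithConv.ext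
  ext x
  change p • ((1 : WithConv (B →ₗ[R] B)) x) = 0
  rw [LinearMap.convOne_apply, ← map_nsmul, nsmul_eq_mul, CharP.cast_eq_zero, zero_mul, map_zero]

/-- In characteristic `p`, `(p : B) = 0` for any `R`-algebra `B`. [folklore] -/
private theorem natCast_eq_zero_of_algebra (R : Type u) [CommSemiring R] (B : Type v) [Semiring B] [Algebra R B] (p : ℕ)
    [CharP R p] : (p : B) = 0 := by
  rw [← map_natCast (algebraMap R B), CharP.cast_eq_zero, map_zero]

variable [IsCocomm R B] [Fact p.Prime]

/-- **`[p^f] = Σᵢ (eⁱ)^{p^f} • (e i)^{p^f}`** (Cartier's trick): on a commutative cocommutative bialgebra `B`, finite free with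
basis `e` over a ring of prime characteristic `p`, the `p^f`-th convolution power of the identity (multiplication by `p^f` on
`Spec B`) is the sum of the rank-one maps `x ↦ (eⁱ)^{p^f}(x) • (e i)^{p^f}`, `(eⁱ)^{p^f}` the convolution power of `e.coord i` in
`WithConv (Module.Dual R B)`: `id = Σ uᵢ` (rank one), the convolution ring is commutative of characteristic `p`, so
`id^{p^f} = Σ uᵢ^{p^f}`.  Sharpens [Tate1997FiniteFlatGroupSchemes] Lemma 3.7.3 (§5) for commutative `G`.
[cite: SGA3I, Exp. VII_A §4.3 (`V_G ∘ F_G = p · id_G`)] [cite: Tate1997FiniteFlatGroupSchemes, Lemma 3.7.3 p. 141; §(3.8) pp. 143–145] -/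
theorem convPow_id_prime_pow_eq_sum {ι : Type w} [Fintype ι] (e : Basis ι R B) (f : ℕ) :
    (toConv LinearMap.id : WithConv (B →ₗ[R] B)) ^ p ^ f =
      ∑ i, toConv ((toConv (e.coord i) ^ p ^ f : WithConv (Module.Dual R B)).ofConv.smulRight
        (e i ^ p ^ f)) := by
  rcases subsingleton_or_nontrivial B with hB | hB
  · apply WithConv.ext
    ext x
    exact Subsingleton.elim _ _
  · haveI : CharP (WithConv (B →ₗ[R] B)) p :=
      (CharP.charP_iff_prime_eq_zero Fact.out).2 (natCast_conv_eq_zero (R := R) (B := B) p)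
    rw [toConv_id_eq_sum_smulRight e, sum_pow_char_pow]
    exact Finset.sum_congr rfl fun i _ => smulRight_convPow _ _ _

/-- **`[p^f] x = Σᵢ (eⁱ)^{p^f}(x) • (e i)^{p^f}`** — the pointwise form of `convPow_id_prime_pow_eq_sum`.
[cite: SGA3I, Exp. VII_A §4.3] [cite: Tate1997FiniteFlatGroupSchemes, Lemma 3.7.3 p. 141] -/
theorem convPow_id_prime_pow_apply {ι : Type w} [Fintype ι] (e : Basis ι R B) (f : ℕ) (x : B) :
    ((toConv LinearMap.id : WithConv (B →ₗ[R] B)) ^ p ^ f) x =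
      ∑ i, (toConv (e.coord i) ^ p ^ f : WithConv (Module.Dual R B)) x • e i ^ p ^ f := by
  rw [convPow_id_prime_pow_eq_sum p e f, ofConv_sum, LinearMap.coe_sum, Finset.sum_apply]
  rfl

/-- **multiplication by `p^f` lands in the span of the `p^f`-th powers** («`[p^f]` factors through the `f`-th relative
Frobenius», i.e. `V^f ∘ F^f = p^f` read without naming the Verschiebung): for a finite free commutative cocommutative
bialgebra `B` over a ring of prime characteristic `p`, `[p^f] x ∈ span_R {b ^ p^f : b ∈ B}` for every `x ∈ B`.
[cite: SGA3I, Exp. VII_A §4.3] [cite: Tate1997FiniteFlatGroupSchemes, Lemma 3.7.3 p. 141] -/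
theorem convPow_id_prime_pow_mem_span [Module.Finite R B] [Module.Free R B] (f : ℕ) (x : B) :
    ((toConv LinearMap.id : WithConv (B →ₗ[R] B)) ^ p ^ f) x ∈
      Submodule.span R (Set.range fun b : B => b ^ p ^ f) := by
  rw [convPow_id_prime_pow_apply p (Module.Free.chooseBasis R B) f x]
  exact Submodule.sum_mem _ fun i _ => Submodule.smul_mem _ _ (Submodule.subset_span ⟨_, rfl⟩)

end CharP

/-! ## §3 The augmentation ideal: `ε ∘ [n] = ε`, and `[q]` maps `I = ker ε` into the span of `{b^q : b ∈ I}` -/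

section Augmentation

variable {R : Type u} [CommRing R] {B : Type v} [CommRing B] [Bialgebra R B]

/-- **`ε ∘ [n] = ε`** (`ε` is an algebra map and the unit of `WithConv (Module.Dual R B)`; Tate: `([n] f)(1) = f(1ⁿ) = f(1)`).
[cite: Tate1997FiniteFlatGroupSchemes, §3.7 p. 141 (Notation `[m]`)] -/
theorem counit_comp_convPow_id (n : ℕ) :
    Coalgebra.counit ∘ₗ ((toConv LinearMap.id : WithConv (B →ₗ[R] B)) ^ n).ofConv =
      (Coalgebra.counit : B →ₗ[R] R) := by
  induction n with
  | zero =>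
    ext x
    change Coalgebra.counit ((1 : WithConv (B →ₗ[R] B)) x) = Coalgebra.counit x
    rw [LinearMap.convOne_apply, Bialgebra.counit_algebraMap]
  | succ n ih =>
    have h := LinearMap.algHom_comp_convMul_distrib (Bialgebra.counitAlgHom R B)
      ((toConv LinearMap.id : WithConv (B →ₗ[R] B)) ^ n) (toConv LinearMap.id)
    rw [Bialgebra.toLinearMap_counitAlgHom] at h
    rw [pow_succ, h, ih, LinearMap.comp_id]
    have h1 : (toConv (Coalgebra.counit : B →ₗ[R] R) : WithConv (Module.Dual R B)) = 1 := by
      apply WithConv.ext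
      ext x
      change Coalgebra.counit x = (1 : WithConv (Module.Dual R B)) x
      rw [LinearMap.convOne_apply, Algebra.algebraMap_self_apply]
    rw [h1, mul_one, ← h1]

/-- `ε ([n] x) = ε x`, pointwise form of `counit_comp_convPow_id`.
[cite: Tate1997FiniteFlatGroupSchemes, §3.7 p. 141 (Notation `[m]`)] -/
theorem counit_convPow_id_apply (n : ℕ) (x : B) :
    Coalgebra.counit (R := R) (((toConv LinearMap.id : WithConv (B →ₗ[R] B)) ^ n) x) = Coalgebra.counit x :=
  LinearMap.congr_fun (counit_comp_convPow_id (R := R) (B := B) n) x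

variable (p : ℕ) [CharP R p]

/-- `b^q ∈ span_R {b₀^q : ε b₀ = 0} + R·1` (`b = b₀ + ε(b)·1`, `b^q = b₀^q + ε(b)^q·1` in characteristic `p`). [folklore] -/
private theorem pow_prime_pow_mem_span_sup [Fact p.Prime] (f : ℕ) (b : B) :
    b ^ p ^ f ∈ Submodule.span R ((fun b : B => b ^ p ^ f) '' (RingHom.ker (Bialgebra.counitAlgHom R B) : Set B)) ⊔
      Submodule.span R {(1 : B)} := by
  rcases subsingleton_or_nontrivial B with hB | hB
  · rw [Subsingleton.elim (b ^ p ^ f) 0]; exact Submodule.zero_mem _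
  · haveI : CharP B p := (CharP.charP_iff_prime_eq_zero Fact.out).2 (natCast_eq_zero_of_algebra R B p)
    set b₀ : B := b - algebraMap R B (Coalgebra.counit (R := R) b) with hb₀
    have hε : b₀ ∈ (RingHom.ker (Bialgebra.counitAlgHom R B) : Set B) := by
      rw [SetLike.mem_coe, RingHom.mem_ker, hb₀, map_sub, Bialgebra.counitAlgHom_apply, Bialgebra.counitAlgHom_apply,
        Bialgebra.counit_algebraMap, sub_self]
    have hdec : b ^ p ^ f = b₀ ^ p ^ f + (Coalgebra.counit (R := R) b) ^ p ^ f • (1 : B) := by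
      have : b = b₀ + algebraMap R B (Coalgebra.counit (R := R) b) := by rw [hb₀, sub_add_cancel]
      conv_lhs => rw [this]
      rw [add_pow_char_pow, ← map_pow, Algebra.algebraMap_eq_smul_one]
    rw [hdec]
    exact Submodule.add_mem_sup (Submodule.subset_span ⟨b₀, hε, rfl⟩)
      (Submodule.smul_mem _ _ (Submodule.subset_span rfl))

/-- The counit kills `span_R {b^{p^f} : ε b = 0}` when `1 ≤ p ^ f` (`ε (b^q) = (ε b)^q = 0`). [folklore] -/
private theorem counit_eq_zero_of_mem_span_pow {q : ℕ} (hq : q ≠ 0) {y : B}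
    (hy : y ∈ Submodule.span R ((fun b : B => b ^ q) '' (RingHom.ker (Bialgebra.counitAlgHom R B) : Set B))) :
    Coalgebra.counit (R := R) y = 0 := by
  induction hy using Submodule.span_induction with
  | mem y hy =>
    obtain ⟨b, hb, rfl⟩ := hy
    rw [SetLike.mem_coe, RingHom.mem_ker, Bialgebra.counitAlgHom_apply] at hb
    change Coalgebra.counit (R := R) (b ^ q) = 0
    rw [Bialgebra.counit_pow, hb, zero_pow hq]
  | zero => exact map_zero _
  | add y z _ _ hy hz => rw [map_add, hy, hz, add_zero]
  | smul r y _ hy => rw [map_smul, hy, smul_zero]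

variable [IsCocomm R B] [Fact p.Prime]

/-- **`[p^f]` maps the augmentation ideal into the span of the `p^f`-th powers of its elements**: `x ∈ I = ker ε ⇒
[p^f] x ∈ span_R {b ^ p^f : b ∈ I}` (`B` finite free commutative cocommutative, `char R = p`; from §2,
`span {b^q} ≤ span {b₀^q : ε b₀ = 0} + R·1` and the `R·1`-component is `ε([q] x) = ε x = 0`).
[cite: SGA3I, Exp. VII_A §4.3] [cite: Tate1997FiniteFlatGroupSchemes, Lemma 3.7.3 p. 141] -/
theorem convPow_id_prime_pow_mem_span_of_mem_ker [Module.Finite R B] [Module.Free R B] (f : ℕ) {x : B}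
    (hx : x ∈ RingHom.ker (Bialgebra.counitAlgHom R B)) :
    ((toConv LinearMap.id : WithConv (B →ₗ[R] B)) ^ p ^ f) x ∈
      Submodule.span R ((fun b : B => b ^ p ^ f) '' (RingHom.ker (Bialgebra.counitAlgHom R B) : Set B)) := by
  set S := Submodule.span R ((fun b : B => b ^ p ^ f) '' (RingHom.ker (Bialgebra.counitAlgHom R B) : Set B))
  have hq : p ^ f ≠ 0 := pow_ne_zero f (Fact.out : p.Prime).ne_zero
  have h1 : ((toConv LinearMap.id : WithConv (B →ₗ[R] B)) ^ p ^ f) x ∈ S ⊔ Submodule.span R {(1 : B)} := by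
    refine (Submodule.span_le.2 ?_) (convPow_id_prime_pow_mem_span (R := R) (B := B) p f x)
    rintro _ ⟨b, rfl⟩
    exact pow_prime_pow_mem_span_sup (R := R) (B := B) p f b
  obtain ⟨s, hs, t, ht, hst⟩ := Submodule.mem_sup.1 h1
  obtain ⟨r, rfl⟩ := Submodule.mem_span_singleton.1 ht
  have hr : r = 0 := by
    have h := congrArg (Coalgebra.counit (R := R) (A := B)) hst
    rw [RingHom.mem_ker, Bialgebra.counitAlgHom_apply] at hx
    rw [counit_convPow_id_apply, hx, map_add, counit_eq_zero_of_mem_span_pow (R := R) hq hs, zero_add,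
      map_smul, Bialgebra.counit_one, smul_eq_mul, mul_one] at h
    exact h
  rw [← hst, hr, zero_smul, add_zero]
  exact hs

end Augmentation

/-! ## §4 Group-scheme dress: `WithConv (B →ₐ[R] B)` and points `WithConv (B →ₐ[R] R')` -/

section AlgHomDress

variable {R : Type u} [CommRing R] {B : Type v} [CommRing B] [Bialgebra R B]

/-- The algebra-hom convolution power `[n] ∈ WithConv (B →ₐ[R] B)` acts as the linear one (Mathlib
`AlgHom.toLinearMap_convPow`). [folklore] -/
private theorem algHom_convPow_id_apply (n : ℕ) (x : B) :
    ((toConv (AlgHom.id R B)) ^ n) x = ((toConv LinearMap.id : WithConv (B →ₗ[R] B)) ^ n) x :=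
  congrArg (fun F : WithConv (B →ₗ[R] B) => F x) (AlgHom.toLinearMap_convPow (toConv (AlgHom.id R B)) n)

/-- **points compose with `[n]` as powers**: `g ∘ [n] = g ^ n` in `WithConv (B →ₐ[R] R')` for every point `g : B →ₐ[R] R'`
(Tate's defining formula `([m] f)(x) = f(x^m)`). [cite: Tate1997FiniteFlatGroupSchemes, §3.7 p. 141 (Notation `[m]`)] -/
theorem comp_algHom_convPow_id {R' : Type w} [CommRing R'] [Algebra R R'] (g : B →ₐ[R] R') (n : ℕ) :
    g.comp ((toConv (AlgHom.id R B)) ^ n).ofConv = ((toConv g) ^ n).ofConv := by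
  induction n with
  | zero =>
    rw [pow_zero, pow_zero, AlgHom.convOne_def, AlgHom.convOne_def]
    change g.comp ((Algebra.ofId R B).comp (Bialgebra.counitAlgHom R B)) = _
    rw [← AlgHom.comp_assoc, Algebra.comp_ofId]
  | succ n ih =>
    rw [pow_succ, AlgHom.comp_convMul_distrib, ih, AlgHom.comp_id, toConv_ofConv, ← pow_succ]

variable (p : ℕ) [CharP R p] [IsCocomm R B] [Fact p.Prime] [Module.Finite R B] [Module.Free R B]

/-- **the ideal of `G[p^f]` lies in the ideal of `ker F^f`**: `[p^f]^*(I) · B ≤ ({b^{p^f} : b ∈ I}) · B` for the augmentation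
ideal `I = ker ε` of a finite free commutative cocommutative bialgebra over a ring of prime characteristic `p` — i.e.
**`ker F_G^f ⊆ G[p^f]`** as closed subgroup schemes of `G = Spec B` ([Tate1997FiniteFlatGroupSchemes] §3.7:
`Ker F = Spec(k[x]⧸(xᵢ^p))`; the kernel of `[q]` is cut out by `[q]^*(I)`).
[cite: SGA3I, Exp. VII_A §4.3] [cite: Tate1997FiniteFlatGroupSchemes, Lemma 3.7.3 p. 141] -/
theorem map_convPow_id_ker_counit_le_span_pow (f : ℕ) :
    Ideal.map ((toConv (AlgHom.id R B)) ^ p ^ f).ofConv (RingHom.ker (Bialgebra.counitAlgHom R B)) ≤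
      Ideal.span ((fun b : B => b ^ p ^ f) '' (RingHom.ker (Bialgebra.counitAlgHom R B) : Set B)) := by
  refine Ideal.map_le_iff_le_comap.2 fun x hx => ?_
  rw [Ideal.mem_comap]
  have h := convPow_id_prime_pow_mem_span_of_mem_ker (R := R) (B := B) p f hx
  rw [← algHom_convPow_id_apply] at h
  exact Submodule.span_le_restrictScalars R B _ h

/-- **a group killed by the `f`-th Frobenius is killed by `p^f`**: if `b ^ p^f = 0` for every `b` in the augmentation ideal
(i.e. `F_G^f = 0` on `G = Spec B`), then `[p^f] = 1` in `WithConv (B →ₐ[R] B)`.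
[cite: SGA3I, Exp. VII_A §4.3] [cite: Tate1997FiniteFlatGroupSchemes, Lemma 3.7.3 p. 141] -/
theorem algHom_convPow_id_prime_pow_eq_one (f : ℕ)
    (hF : ∀ b ∈ RingHom.ker (Bialgebra.counitAlgHom R B), b ^ p ^ f = 0) :
    (toConv (AlgHom.id R B)) ^ p ^ f = 1 := by
  apply WithConv.ext
  apply AlgHom.toLinearMap_injective
  ext x
  change ((toConv (AlgHom.id R B)) ^ p ^ f) x = (1 : WithConv (B →ₐ[R] B)) x
  rw [AlgHom.convOne_apply, algHom_convPow_id_apply]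
  set x₀ : B := x - algebraMap R B (Coalgebra.counit (R := R) x) with hx₀
  have hε : x₀ ∈ RingHom.ker (Bialgebra.counitAlgHom R B) := by
    rw [RingHom.mem_ker, hx₀, map_sub, Bialgebra.counitAlgHom_apply, Bialgebra.counitAlgHom_apply,
      Bialgebra.counit_algebraMap, sub_self]
  have hspan : Submodule.span R ((fun b : B => b ^ p ^ f) '' (RingHom.ker (Bialgebra.counitAlgHom R B) : Set B)) = ⊥ := by
    rw [Submodule.span_eq_bot]
    rintro _ ⟨b, hb, rfl⟩
    exact hF b hb
  have h0 : ((toConv LinearMap.id : WithConv (B →ₗ[R] B)) ^ p ^ f) x₀ = 0 := by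
    have := convPow_id_prime_pow_mem_span_of_mem_ker (R := R) (B := B) p f hε
    rwa [hspan, Submodule.mem_bot] at this
  have h1 : ((toConv LinearMap.id : WithConv (B →ₗ[R] B)) ^ p ^ f) (algebraMap R B (Coalgebra.counit (R := R) x)) =
      algebraMap R B (Coalgebra.counit (R := R) x) := by
    rw [← algHom_convPow_id_apply]
    exact AlgHom.commutes _ _
  have hx : x = x₀ + algebraMap R B (Coalgebra.counit (R := R) x) := by rw [hx₀, sub_add_cancel]
  conv_lhs => rw [hx]
  rw [map_add, h0, h1, zero_add]

/-- **points of a group killed by `F^f` have order dividing `p^f`**: under the hypothesis of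
`algHom_convPow_id_prime_pow_eq_one`, every point `g ∈ G(R') = WithConv (B →ₐ[R] R')` satisfies `g ^ p^f = 1`.
[cite: SGA3I, Exp. VII_A §4.3] [cite: Tate1997FiniteFlatGroupSchemes, §(3.8) pp. 143–145] -/
theorem convPow_prime_pow_eq_one_of_forall_pow_eq_zero (f : ℕ)
    (hF : ∀ b ∈ RingHom.ker (Bialgebra.counitAlgHom R B), b ^ p ^ f = 0)
    {R' : Type w} [CommRing R'] [Algebra R R'] (g : B →ₐ[R] R') :
    (toConv g) ^ p ^ f = 1 := by
  apply WithConv.ext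
  rw [← comp_algHom_convPow_id g (p ^ f), algHom_convPow_id_prime_pow_eq_one (R := R) (B := B) p f hF,
    AlgHom.convOne_def, AlgHom.convOne_def]
  change g.comp ((Algebra.ofId R B).comp (Bialgebra.counitAlgHom R B)) = _
  rw [← AlgHom.comp_assoc, Algebra.comp_ofId]

end AlgHomDress

/-! ## §5 [Tate1997FiniteFlatGroupSchemes] Lemma 3.7.3 «`[p] I ⊂ I^p`» for every commutative bialgebra: `[p^m] x − ε(x)·1 ∈ I^{p^m}` -/

section TateLemma

variable {R : Type u} [CommRing R] {B : Type v} [CommRing B] [Bialgebra R B]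

/-- **powers of the projection onto the augmentation ideal**: for `π := id − 1` in `WithConv (B →ₗ[R] B)` (`π x = x − ε(x)·1`),
`πⁿ x ∈ Iⁿ` for all `x` (`πⁿ⁺¹ x = Σ πⁿ(xᵢ') π(xᵢ'')`) — the mechanism of [Tate1997FiniteFlatGroupSchemes] Lemma 3.7.3, there via
the regular representation `(U − 1)^p`. [cite: Tate1997FiniteFlatGroupSchemes, Lemma 3.7.3 pp. 141–142 (proof)] -/
theorem convPow_id_sub_one_apply_mem_pow (n : ℕ) (x : B) :
    (((toConv LinearMap.id : WithConv (B →ₗ[R] B)) - 1) ^ n) x ∈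
      RingHom.ker (Bialgebra.counitAlgHom R B) ^ n := by
  induction n generalizing x with
  | zero => rw [pow_zero, pow_zero, Ideal.one_eq_top]; exact Submodule.mem_top
  | succ n ih =>
    rw [pow_succ ((toConv LinearMap.id : WithConv (B →ₗ[R] B)) - 1), (ℛ R x).convMul_apply, pow_succ]
    refine Ideal.sum_mem _ fun i _ => Ideal.mul_mem_mul (ih _) ?_
    have h1 : (((toConv LinearMap.id : WithConv (B →ₗ[R] B)) - 1) ((ℛ R x).right i)) =
        (ℛ R x).right i - algebraMap R B (Coalgebra.counit (R := R) ((ℛ R x).right i)) := rfl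
    rw [h1, RingHom.mem_ker, map_sub, Bialgebra.counitAlgHom_apply, Bialgebra.counitAlgHom_apply,
      Bialgebra.counit_algebraMap, sub_self]

variable (p : ℕ) [Fact p.Prime] [CharP R p]

/-- **Tate's Lemma 3.7.3, element form**: over `R` with `pR = 0`, for every commutative `R`-bialgebra `B` (no finiteness or
flatness needed here) and every `x`, `[p^m] x − ε(x)·1 ∈ I^{p^m}`, `I = ker ε`: in the convolution ring (characteristic `p`,
`id` commutes with `1`) `[p^m] − 1 = (id − 1)^{p^m} = π^{p^m}`, and `πⁿ x ∈ Iⁿ`.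
[cite: Tate1997FiniteFlatGroupSchemes, Lemma 3.7.3 p. 141 («`[p] I ⊂ I^p`») and p. 142 («iterating `m` times gives `[q](I) ⊂ I^q`»)] -/
theorem convPow_id_prime_pow_apply_sub_mem_pow (m : ℕ) (x : B) :
    ((toConv LinearMap.id : WithConv (B →ₗ[R] B)) ^ p ^ m) x - algebraMap R B (Coalgebra.counit (R := R) x) ∈
      RingHom.ker (Bialgebra.counitAlgHom R B) ^ p ^ m := by
  rcases subsingleton_or_nontrivial B with hB | hB
  · rw [Subsingleton.elim (_ - _) 0]; exact Ideal.zero_mem _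
  · haveI : CharP (WithConv (B →ₗ[R] B)) p :=
      (CharP.charP_iff_prime_eq_zero Fact.out).2 (natCast_conv_eq_zero (R := R) (B := B) p)
    have hcomm : Commute (toConv LinearMap.id : WithConv (B →ₗ[R] B)) 1 := Commute.one_right _
    have h := convPow_id_sub_one_apply_mem_pow (R := R) (B := B) (p ^ m) x
    rw [sub_pow_char_pow_of_commute (R := WithConv (B →ₗ[R] B)) p m hcomm, one_pow] at h
    change ((toConv LinearMap.id : WithConv (B →ₗ[R] B)) ^ p ^ m).ofConv x - (1 : WithConv (B →ₗ[R] B)) x ∈ _ at h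
    rwa [LinearMap.convOne_apply] at h

/-- **Tate's Lemma 3.7.3**: `[p^m](I) ⊂ I^{p^m}` for the augmentation ideal `I = ker ε` of a commutative bialgebra over a ring
with `pR = 0` (`[p^m] ∈ WithConv (B →ₐ[R] B)`; `m = 1` is the printed «`[p] I ⊂ I^p`», stated there, after Andreatta–Schoof and
Edixhoven, for finite free `G` or closed subgroups of `GL_n`). [cite: Tate1997FiniteFlatGroupSchemes, Lemma 3.7.3 pp. 141–142] -/
theorem map_convPow_id_ker_counit_le_pow (m : ℕ) :
    Ideal.map ((toConv (AlgHom.id R B)) ^ p ^ m).ofConv (RingHom.ker (Bialgebra.counitAlgHom R B)) ≤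
      RingHom.ker (Bialgebra.counitAlgHom R B) ^ p ^ m := by
  refine Ideal.map_le_iff_le_comap.2 fun x hx => ?_
  rw [Ideal.mem_comap]
  have hx' : Coalgebra.counit (R := R) x = 0 := by
    rwa [RingHom.mem_ker, Bialgebra.counitAlgHom_apply] at hx
  have h := convPow_id_prime_pow_apply_sub_mem_pow (R := R) (B := B) p m x
  rwa [hx', map_zero, sub_zero, ← algHom_convPow_id_apply] at h

end TateLemma

end Literature.RingTheory.HopfAlgebra
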